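import Summits.NavierStokesRegularity.NavierStokesRegularity.Theses.FilamentSkeletonRss

/-!
# `RdssProfileTruncation` (stmt-NavierStokesRegularity-11289): what the factor guard `1 < c` carries

Negative-side support for crux `RdssProfileTruncation` of routes `FilamentSkeletonRss` (#4) and
`CorkscrewDynamo` (#3) (cdisprove seat, cycle 1, 2026-08-16; crux workfile
`Cruxes/RdssProfileTruncation/Disproof.lean`).  The antecedent quantifies `∃ c R u, 1 < c ∧ … ∧
IsRotatedDSS c R u ∧ …`.  Kernel-checked facts:

* `isRotatedDSS_one_refl'` — `(1, id)`-RDSS holds for EVERY field, so WITHOUT the guard the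
  antecedent degenerates to "a nontrivial Type-I ancient mild solution with measurable slices exists"
  (no self-similarity at all: the failure of the Type-I ancient Liouville theorem, open), and the
  guard-free bridge is the corresponding STRONGER bridge
  (`rdssProfileTruncation_withoutFactorGuard_iff`);
* `isRotatedDSS_neg_iff'`, `isRotatedDSS_inv'`, `isRotatedDSS_zero_iff'` — negative factors are
  positive factors with `R` composed with `−1 ∈ O(3)`, factors in `(0,1)` are factors `> 1` for
  `R⁻¹`, factor `0` forces `u ≡ 0`; hence the antecedent with the guard replaced by
  `c ≠ 0 ∧ |c| ≠ 1` is EQUIVALENT to the stated one (`rdssProfileTruncation_antecedent_iff_of_abs_ne_one`):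
  `1 < c` is a pure normalisation except for excluding `|c| = 1`.
-/

set_option linter.dupNamespace false

noncomputable section

namespace Summit.NavierStokesRegularity.NavierStokesRegularity.Theorems.RdssProfileTruncation.Negative

open Literature.Analysis.FluidPDE MeasureTheory

section Algebra

variable {E : Type*} [NormedAddCommGroup E] [NormedSpace ℝ E]

/-- `(1, id)`-RDSS holds for every field. [folklore] -/
theorem isRotatedDSS_one_refl' (u : ℝ → E → E) : IsRotatedDSS 1 (LinearIsometryEquiv.refl ℝ E) u := by
  intro t x
  simp [show (LinearIsometryEquiv.refl ℝ E).symm = LinearIsometryEquiv.refl ℝ E from rfl]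

/-- Factor `0` forces the zero field (at all times). [folklore] -/
theorem isRotatedDSS_zero_iff' (R : E ≃ₗᵢ[ℝ] E) (u : ℝ → E → E) :
    IsRotatedDSS 0 R u ↔ ∀ t x, u t x = 0 := by
  simp only [IsRotatedDSS, zero_smul]
  exact ⟨fun h t x => (h t x).symm, fun h t x => (h t x).symm⟩

/-- `(−c, R ∘ (−1))`-RDSS ↔ `(c, R)`-RDSS. [folklore] -/
theorem isRotatedDSS_neg_iff' (c : ℝ) (R : E ≃ₗᵢ[ℝ] E) (u : ℝ → E → E) :
    IsRotatedDSS (-c) (R.trans (LinearIsometryEquiv.neg ℝ)) u ↔ IsRotatedDSS c R u := by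
  simp only [IsRotatedDSS, LinearIsometryEquiv.trans_apply, LinearIsometryEquiv.coe_neg,
    LinearIsometryEquiv.symm_trans, LinearIsometryEquiv.symm_neg, neg_sq, smul_neg, neg_smul,
    neg_neg, map_neg]

/-- `(c, R)`-RDSS with `c ≠ 0` gives `(c⁻¹, R⁻¹)`-RDSS. [folklore] -/
theorem isRotatedDSS_inv' {c : ℝ} {R : E ≃ₗᵢ[ℝ] E} {u : ℝ → E → E} (h : IsRotatedDSS c R u)
    (hc : c ≠ 0) : IsRotatedDSS c⁻¹ R.symm u := by
  intro t x
  have key := h (c⁻¹ ^ 2 * t) (c⁻¹ • R.symm x)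
  have h1 : c ^ 2 * (c⁻¹ ^ 2 * t) = t := by field_simp
  have h2 : c • R (c⁻¹ • R.symm x) = x := by
    rw [map_smul, LinearIsometryEquiv.apply_symm_apply, smul_smul, mul_inv_cancel₀ hc, one_smul]
  rw [h1, h2] at key
  rw [LinearIsometryEquiv.symm_symm, ← key, map_smul, LinearIsometryEquiv.apply_symm_apply, smul_smul,
    inv_mul_cancel₀ hc, one_smul]

end Algebra

/-- **Without the guard `1 < c` the bridge is the Type-I-ancient bridge.**  The guard-free
antecedent `∃ c R u, mild ∧ measurable ∧ (c,R)-RDSS ∧ Type-I ∧ nontrivial` is equivalent to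
"a nontrivial Type-I ancient mild solution with measurable slices exists" (take `c = 1`, `R = id`),
so the two bridges to the (verbatim) conclusion X5a coincide. [folklore] -/
theorem rdssProfileTruncation_withoutFactorGuard_iff :
    ((∃ (c : ℝ) (R : (EuclideanSpace ℝ (Fin 3)) ≃ₗᵢ[ℝ] (EuclideanSpace ℝ (Fin 3)))
        (u : ℝ → (EuclideanSpace ℝ (Fin 3)) → (EuclideanSpace ℝ (Fin 3))), IsAncientMildSolution 1 u ∧
        (∀ t < 0, AEStronglyMeasurable (u t) volume) ∧ IsRotatedDSS c R u ∧
        (∃ C₀ : ℝ, HasTypeIDecay C₀ u) ∧ ¬ (∀ t < 0, u t =ᵐ[volume] 0)) →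
      ∃ ν : ℝ, 0 < ν ∧ ∃ T : ℝ, 0 < T ∧ ∃ (u : ℝ → (EuclideanSpace ℝ (Fin 3)) → (EuclideanSpace ℝ (Fin 3)))
        (p : ℝ → (EuclideanSpace ℝ (Fin 3)) → ℝ),
        IsMaximalSmoothSolution ν 0 u p T ∧ IsLerayHopfOn T ν 0 (u 0) u ∧
        HasRapidSpatialDecay (u 0)) ↔
    ((∃ u : ℝ → (EuclideanSpace ℝ (Fin 3)) → (EuclideanSpace ℝ (Fin 3)), IsAncientMildSolution 1 u ∧
        (∀ t < 0, AEStronglyMeasurable (u t) volume) ∧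
        (∃ C₀ : ℝ, HasTypeIDecay C₀ u) ∧ ¬ (∀ t < 0, u t =ᵐ[volume] 0)) →
      ∃ ν : ℝ, 0 < ν ∧ ∃ T : ℝ, 0 < T ∧ ∃ (u : ℝ → (EuclideanSpace ℝ (Fin 3)) → (EuclideanSpace ℝ (Fin 3)))
        (p : ℝ → (EuclideanSpace ℝ (Fin 3)) → ℝ),
        IsMaximalSmoothSolution ν 0 u p T ∧ IsLerayHopfOn T ν 0 (u 0) u ∧
        HasRapidSpatialDecay (u 0)) := by
  constructor
  · rintro h ⟨u, hm, hmeas, hC, hnz⟩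
    exact h ⟨1, LinearIsometryEquiv.refl ℝ _, u, hm, hmeas, isRotatedDSS_one_refl' u, hC, hnz⟩
  · rintro h ⟨c, R, u, hm, hmeas, -, hC, hnz⟩
    exact h ⟨u, hm, hmeas, hC, hnz⟩

/-- **`1 < c` is a normalisation of `c ≠ 0 ∧ |c| ≠ 1`.**  The antecedent with the guard so relaxed
is equivalent to the stated antecedent (negative factor: compose `R` with `−1`; factor in `(0,1)`:
invert and pass to `R⁻¹`). [folklore] -/
theorem rdssProfileTruncation_antecedent_iff_of_abs_ne_one :
    (∃ (c : ℝ) (R : (EuclideanSpace ℝ (Fin 3)) ≃ₗᵢ[ℝ] (EuclideanSpace ℝ (Fin 3)))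
        (u : ℝ → (EuclideanSpace ℝ (Fin 3)) → (EuclideanSpace ℝ (Fin 3))), c ≠ 0 ∧ |c| ≠ 1 ∧
        IsAncientMildSolution 1 u ∧ (∀ t < 0, AEStronglyMeasurable (u t) volume) ∧ IsRotatedDSS c R u ∧
        (∃ C₀ : ℝ, HasTypeIDecay C₀ u) ∧ ¬ (∀ t < 0, u t =ᵐ[volume] 0)) ↔
    (∃ (c : ℝ) (R : (EuclideanSpace ℝ (Fin 3)) ≃ₗᵢ[ℝ] (EuclideanSpace ℝ (Fin 3)))
        (u : ℝ → (EuclideanSpace ℝ (Fin 3)) → (EuclideanSpace ℝ (Fin 3))), 1 < c ∧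
        IsAncientMildSolution 1 u ∧ (∀ t < 0, AEStronglyMeasurable (u t) volume) ∧ IsRotatedDSS c R u ∧
        (∃ C₀ : ℝ, HasTypeIDecay C₀ u) ∧ ¬ (∀ t < 0, u t =ᵐ[volume] 0)) := by
  constructor
  · rintro ⟨c, R, u, hc0, hc1, hm, hmeas, hdss, hC, hnz⟩
    -- first make the factor positive
    obtain ⟨c', R', hc'0, hc'1, hdss'⟩ : ∃ (c' : ℝ)
        (R' : (EuclideanSpace ℝ (Fin 3)) ≃ₗᵢ[ℝ] (EuclideanSpace ℝ (Fin 3))),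
        0 < c' ∧ c' ≠ 1 ∧ IsRotatedDSS c' R' u := by
      rcases lt_or_gt_of_ne hc0 with hneg | hpos
      · exact ⟨-c, R.trans (LinearIsometryEquiv.neg ℝ), neg_pos.2 hneg,
          fun h1 => hc1 (by rw [abs_of_neg hneg, h1]), (isRotatedDSS_neg_iff' c R u).2 hdss⟩
      · exact ⟨c, R, hpos, fun h1 => hc1 (by rw [abs_of_pos hpos, h1]), hdss⟩
    -- then make it larger than `1`
    rcases lt_or_gt_of_ne hc'1 with hlt | hgt
    · exact ⟨c'⁻¹, R'.symm, u, one_lt_inv_iff₀.2 ⟨hc'0, hlt⟩, hm, hmeas, isRotatedDSS_inv' hdss' hc'0.ne',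
        hC, hnz⟩
    · exact ⟨c', R', u, hgt, hm, hmeas, hdss', hC, hnz⟩
  · rintro ⟨c, R, u, hc, hm, hmeas, hdss, hC, hnz⟩
    exact ⟨c, R, u, (one_pos.trans hc).ne', by rw [abs_of_pos (one_pos.trans hc)]; exact hc.ne', hm,
      hmeas, hdss, hC, hnz⟩

end Summit.NavierStokesRegularity.NavierStokesRegularity.Theorems.RdssProfileTruncation.Negative
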